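import Literature.AlgebraicGeometry.Frobenioids.CircleOpensArcs
import HarnessLib

/-!
# Frobenioids II, Lemma 3.2: proofs of (ii) first sentence, (iv), (ix)

Mochizuki, *The geometry of Frobenioids II*, Kyushu J. Math. **62** (2008) 401–460, §3, Lemma 3.2
pp. 25–27 [cite: MochizukiFrdII2008, Lem 3.2 pp.25-27]. Discharges (proof-only companion) of the
named facts `ItemII_translate`, `ItemIV`, `ItemIX` of `CircleOpens.lean` (abc-iut-L1-t4), from the
arc description of connected open subsets of `S¹` (`CircleOpensArcs.lean`).

Proof notes. (ii): an arc `exp(i·(c, d))` is centred by the translation `exp(-i(c+d)/2)`, and a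
centred arc is invariant under `z ↦ z⁻¹`; `S¹` itself is invariant. (iv) ("angular regions never
shrink", p. 32): for `n ≥ 2` the arc `φ_n(A)` has `n` times the length of `A ≠ S¹`, so it is not
contained in `A` (arc-length monotonicity, or it is all of `S¹`); `n ≤ -2` reduces to `n² ≥ 2`;
for `|n| = 1`, `φ_{-1}(A) ⊆ A` forces equality by applying the involution `φ_{-1}` again. (ix): if
`B ≠ S¹` or `S¹ \ A` has two points, one of the two gaps between `A` and `B` is a nonempty open arc
disjoint from `A`.
-/

namespace Literature.AlgebraicGeometry.Frobenioids

open Set Function Topology Real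
open scoped Pointwise

noncomputable section

namespace CircleOpens

/-! ### Lemma 3.2 (ii), first sentence -/

/-- `x ↦ -x` preserves the symmetric interval `(-r, r)`. [cite: MochizukiFrdII2008, Lem 3.2 (ii) p.25] -/
private theorem image_neg_one_mul_Ioo (r : ℝ) :
    (fun x => (-1 : ℝ) * x) '' Ioo (-r) r = Ioo (-r) r := by
  ext y
  constructor
  · rintro ⟨x, hx, rfl⟩
    exact ⟨by linarith [hx.2], by linarith [hx.1]⟩
  · intro hy
    exact ⟨-y, ⟨by linarith [hy.2], by linarith [hy.1]⟩, by ring⟩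

/-- **Lemma 3.2 (ii)**, first sentence (FrdII p. 25), PROVED: "there exists a `w ∈ S¹` such that
`φ_{-1}(w · A) = w · A`" — centre the arc. [cite: MochizukiFrdII2008, Lem 3.2 (ii) p.25] -/
theorem ItemII_translate_holds : ItemII_translate := by
  intro A hA hAo
  by_cases hU : A = univ
  · refine ⟨1, ?_⟩
    rw [hU, smul_set_univ]
    exact image_univ_of_surjective (phi_surjective (by norm_num))
  · obtain ⟨c, d, -, -, rfl⟩ := exists_eq_exp_image_Ioo hA hAo hU
    refine ⟨Circle.exp (-((c + d) / 2)), ?_⟩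
    rw [exp_smul_exp_image, image_const_add_Ioo, phi_image_exp_image]
    have h1 : -((c + d) / 2) + c = -((d - c) / 2) := by ring
    have h2 : -((c + d) / 2) + d = (d - c) / 2 := by ring
    rw [h1, h2]
    congr 1
    push_cast
    exact image_neg_one_mul_Ioo _

/-! ### Lemma 3.2 (iv) -/

/-- For `n ≥ 2` and a connected open `A ≠ S¹`, `φ_n(A) ⊄ A` (the arc `φ_n(A)` is `n` times as long).
[cite: MochizukiFrdII2008, Lem 3.2 (iv) p.25] -/
theorem not_phi_image_subset_of_two_le {A : Set Circle} (hA : IsConnected A) (hAo : IsOpen A)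
    (hU : A ≠ univ) {n : ℤ} (hn : 2 ≤ n) : ¬ phi n '' A ⊆ A := by
  obtain ⟨c, d, hcd, hlen, rfl⟩ := exists_eq_exp_image_Ioo hA hAo hU
  intro hsub
  have hn' : (2 : ℝ) ≤ n := by exact_mod_cast hn
  have himg : (fun x => (n : ℝ) * x) '' Ioo c d = Ioo ((n : ℝ) * c) ((n : ℝ) * d) :=
    image_mul_left_Ioo (by linarith) c d
  rw [phi_image_exp_image, himg] at hsub
  rcases le_or_gt ((n : ℝ) * d - (n : ℝ) * c) (2 * π) with hle | hlt
  · have := sub_le_sub_of_exp_image_Ioo_subset (by nlinarith) hlen hsub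
    nlinarith
  · rw [exp_image_Ioo_eq_univ hlt] at hsub
    exact hU (univ_subset_iff.mp hsub)

/-- `φ_{-1}` is an involution on subsets. [cite: MochizukiFrdII2008, Lem 3.2 (iv) p.25] -/
theorem phi_neg_one_image_image (s : Set Circle) : phi (-1) '' (phi (-1) '' s) = s := by
  have : phi (-1) ∘ phi (-1) = id := funext fun z => by simp [phi]
  rw [← image_comp, this, image_id]

/-- **Lemma 3.2 (iv)** (FrdII p. 25), PROVED: "Suppose that for some `0 ≠ n ∈ ℤ`, `φ_n(A) ⊆ A`. Then
either `A = S¹` or `|n| = 1`. Moreover, `φ_n(A) = A`" ("angular regions never shrink", p. 32).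
[cite: MochizukiFrdII2008, Lem 3.2 (iv) p.25] -/
theorem ItemIV_holds : ItemIV := by
  intro A hA hAo n hn hsub
  have key : A = univ ∨ |n| = 1 := by
    by_cases hU : A = univ
    · exact Or.inl hU
    right
    by_contra h1
    have h2 : 2 ≤ n * n := by
      have : 1 < |n| := lt_of_le_of_ne (Int.one_le_abs hn) (Ne.symm h1)
      nlinarith [abs_mul_abs_self n, abs_nonneg n]
    have hsub2 : phi (n * n) '' A ⊆ A := by
      have : phi (n * n) = phi n ∘ phi n := funext fun z => by simp [phi, zpow_mul]
      rw [this, image_comp]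
      exact (image_mono hsub).trans hsub
    exact not_phi_image_subset_of_two_le hA hAo hU h2 hsub2
  refine ⟨key, ?_⟩
  rcases key with hU | h1
  · rw [hU, phi_image_univ hn]
  · rcases (abs_eq zero_le_one).mp h1 with rfl | rfl
    · have : phi 1 = id := funext fun z => by simp [phi]
      rw [this, image_id]
    · refine le_antisymm hsub ?_
      calc A = phi (-1) '' (phi (-1) '' A) := (phi_neg_one_image_image A).symm
        _ ⊆ phi (-1) '' A := image_mono hsub

/-! ### Lemma 3.2 (ix) -/

/-- `exp(ic)` is not on the arc `exp(i·(c, d))` when `d ≤ c + 2π`.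
[cite: MochizukiFrdII2008, Lem 3.2 (ix) p.26] -/
theorem exp_left_notMem_exp_image_Ioo {c d : ℝ} (h : d - c ≤ 2 * π) :
    Circle.exp c ∉ Circle.exp '' Ioo c d := by
  rintro ⟨x, hx, hxe⟩
  exact hx.1.ne' (Circle.exp_injOn_Ico (a := c) (b := c + 2 * π) (by linarith)
    ⟨hx.1.le, by linarith [hx.2]⟩ ⟨le_rfl, by linarith [two_pi_pos]⟩ hxe)

/-- **Lemma 3.2 (ix)** (FrdII p. 26), PROVED: "Suppose that `A ≠ B`, and that there does not exist a
connected open subset `D ⊆ B` such that `A ∩ D = ∅`. Then `B = S¹`, and `B \ A` is of cardinality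
`≤ 1`." [cite: MochizukiFrdII2008, Lem 3.2 (ix) p.26] -/
theorem ItemIX_holds : ItemIX := by
  intro A B hAB hne hnoD
  have hB : B = univ := by
    by_contra hBU
    obtain ⟨c, d, hcd, hlen, hBeq⟩ :=
      exists_eq_exp_image_Ioo hAB.isConnected_right hAB.isOpen_right hBU
    have hcA : Circle.exp c ∉ A := fun h => exp_left_notMem_exp_image_Ioo hlen (hBeq ▸ hAB.subset h)
    obtain ⟨a, b, hca, hab, hb2, hAeq⟩ :=
      exists_eq_exp_image_Ioo_of_notMem hAB.isConnected_left hAB.isOpen_left hcA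
    have hper : InjOn Circle.exp (Ico c (c + 2 * π)) := Circle.exp_injOn_Ico (by linarith)
    have hIab : Ioo a b ⊆ Ico c (c + 2 * π) := fun x hx => ⟨hca.trans hx.1.le, hx.2.trans_le hb2⟩
    have hIcd : Ioo c d ⊆ Ico c (c + 2 * π) := fun x hx => ⟨hx.1.le, by linarith [hx.2]⟩
    have hsub : Ioo a b ⊆ Ioo c d := by
      have := hAB.subset
      rw [hAeq, hBeq] at this
      exact (hper.image_subset_image_iff hIab hIcd).mp this
    have hbd : b ≤ d := ((Ioo_subset_Ioo_iff hab).mp hsub).2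
    have hgap : c < a ∨ b < d := by
      by_contra h
      rw [not_or, not_lt, not_lt] at h
      exact hne (by rw [hAeq, hBeq, le_antisymm h.1 hca, le_antisymm hbd h.2])
    rcases hgap with h | h
    · apply hnoD
      refine ⟨Circle.exp '' Ioo c a, isConnected_exp_image_Ioo h, isOpen_exp_image isOpen_Ioo,
        ?_, ?_⟩
      · rw [hBeq]
        exact image_mono (Ioo_subset_Ioo le_rfl (hab.le.trans hbd))
      · rw [hAeq, inter_comm]
        exact exp_image_Ioo_inter_eq_empty (a₀ := c) le_rfl (by linarith) le_rfl hca hb2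
    · apply hnoD
      refine ⟨Circle.exp '' Ioo b d, isConnected_exp_image_Ioo h, isOpen_exp_image isOpen_Ioo,
        ?_, ?_⟩
      · rw [hBeq]
        exact image_mono (Ioo_subset_Ioo (hca.trans hab.le) le_rfl)
      · rw [hAeq]
        exact exp_image_Ioo_inter_eq_empty (a₀ := c) hca hb2 le_rfl (hca.trans hab.le)
          (by linarith)
  refine ⟨hB, ?_⟩
  subst hB
  by_contra hns
  obtain ⟨p, hp, q, hq, hpq⟩ := Set.not_subsingleton_iff.mp hns
  obtain ⟨a₀, rfl⟩ := Circle.exp_surjective p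
  obtain ⟨a, b, ha, hab, hb, hAeq⟩ :=
    exists_eq_exp_image_Ioo_of_notMem hAB.isConnected_left hAB.isOpen_left hp.2
  have hq' : q ∈ ({Circle.exp a₀}ᶜ : Set Circle) := fun h => hpq (mem_singleton_iff.mp h).symm
  rw [← exp_image_Ioo_eq_compl] at hq'
  obtain ⟨y₀, hy₀, rfl⟩ := hq'
  have hy₀A : y₀ ∉ Ioo a b := fun h => hq.2 (hAeq ▸ ⟨y₀, h, rfl⟩)
  rcases le_or_gt y₀ a with hya | hya
  · apply hnoD
    refine ⟨Circle.exp '' Ioo a₀ a, isConnected_exp_image_Ioo (hy₀.1.trans_le hya),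
      isOpen_exp_image isOpen_Ioo, subset_univ _, ?_⟩
    rw [hAeq, inter_comm]
    exact exp_image_Ioo_inter_eq_empty (a₀ := a₀) le_rfl (by linarith) le_rfl ha hb
  · have hyb : b ≤ y₀ := by
      by_contra h
      exact hy₀A ⟨hya, not_le.mp h⟩
    apply hnoD
    refine ⟨Circle.exp '' Ioo b (a₀ + 2 * π), isConnected_exp_image_Ioo (hyb.trans_lt hy₀.2),
      isOpen_exp_image isOpen_Ioo, subset_univ _, ?_⟩
    rw [hAeq]
    exact exp_image_Ioo_inter_eq_empty (a₀ := a₀) ha hb le_rfl (ha.trans hab.le) le_rfl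

end CircleOpens

end

end Literature.AlgebraicGeometry.Frobenioids
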